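import Mathlib.GroupTheory.Perm.Cycle.Type
import Mathlib.Logic.Equiv.Basic
import Literature.Computability.AlgebraicComplexity.PermanentCompleteness
import HarnessLib

/-!
# Hamiltonian cycle sums: base change, reindexing, single-cycle criteria, projections of `HC_n`

Tool lemmas for the Hamiltonian cycle sum `HC(M) = ∑_{π : cycleType π = {#n}} ∏_i M (π i) i`
(`Matrix.hamiltonianCycleSum`, `StandardFamilies.lean`; Bürgisser 2000, (2.3); Valiant 1979),
used by the gadget proof of the `VNP`-hardness of the Hamiltonian cycle family
(von zur Gathen 1987, Thm. 5.6; Bürgisser–Clausen–Shokrollahi 1997, Thm. (21.17)(1)):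

* `Equiv.Perm.cycleType_permCongr`, `Matrix.hamiltonianCycleSum_map_ringHom`,
  `Matrix.hamiltonianCycleSum_submatrix_equiv`: cycle types are invariant under renaming the
  ground set along an equivalence, so `HC` commutes with ring maps and with renaming the
  vertices (deliberate dot-notation extensions of Mathlib's `Equiv.Perm` and `Matrix`
  namespaces, like `Matrix.hamiltonianCycleSum` itself);
* `Equiv.Perm.cycleType_eq_card_of_potential`: a permutation along which a potential
  `τ : V → ℕ` strictly increases, except on the arcs into one vertex `v₀`, is a single cycle
  through all of `V` (the engine behind "the structured cover is Hamiltonian");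
* `Equiv.Perm.pow_apply_ne_self_of_cycleType`: a full cycle has no short return,
  `(π ^ m) x ≠ x` for `0 < m < #V` (kills covers with a small cycle inside a gadget);
* `Matrix.hamiltonianCycleSum_term_eq_zero`: a cover through an entry `0` contributes `0`;
* `entryHC A = HC(A)` for a matrix `A` over `k ∪ {X_i}` (entries in `k ⊕ σ`, as `entryPer` in
  `PermanentCompleteness.lean`), `aeval_entryHC`, and `isProjection_entryHC_hcPoly`: `HC(A)` is a
  projection of the generic `HC_N` (Bürgisser 2000, Def. 2.6(1), (2.3); BCS 1997, (21.12)).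

## References

* J. von zur Gathen, *Feasible arithmetic computations: Valiant's hypothesis*, J. Symbolic
  Comput. 4 (1987) 137–172, §5, Thm. 5.6.
* P. Bürgisser, M. Clausen, M. A. Shokrollahi, *Algebraic Complexity Theory*, Springer 1997,
  (21.12), Thm. (21.17).
* P. Bürgisser, *Completeness and Reduction in Algebraic Complexity Theory*, Springer 2000,
  (2.3), Def. 2.6.
-/

noncomputable section

open Equiv Finset

/-! ### Cycle types under renaming of the ground set -/

namespace Equiv.Perm

variable {α β : Type*} [Fintype α] [DecidableEq α] [Fintype β] [DecidableEq β]

/-- Renaming the ground set along `e : α ≃ β` (`Equiv.permCongr`) preserves the cycle type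
(via `Equiv.Perm.cycleType_extendDomain` with the full subtype of `β`). Deliberate dot-notation
extension of Mathlib's `Equiv.Perm` namespace. [folklore] -/
theorem cycleType_permCongr (e : α ≃ β) (g : Perm α) :
    (e.permCongr g).cycleType = g.cycleType := by
  let f : α ≃ Subtype (fun _ : β => True) :=
    e.trans (Equiv.subtypeUnivEquiv (fun _ => trivial)).symm
  have hfe : ∀ a, ((f a : Subtype fun _ : β => True) : β) = e a := fun a => rfl
  have h : e.permCongr g = g.extendDomain f := by
    ext y
    obtain ⟨a, rfl⟩ := e.surjective y
    rw [Equiv.permCongr_apply, Equiv.symm_apply_apply, ← hfe a,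
      Equiv.Perm.extendDomain_apply_image, hfe]
  rw [h, cycleType_extendDomain]

/-- **A potential makes a permutation a full cycle.** If `τ : V → ℕ` strictly increases along
every arc `x ↦ π x` of the permutation `π` except the arcs into the vertex `v₀`, and `V` has at
least two elements, then `π` is a single cycle through all of `V`: `cycleType π = {#V}`.
(Every orbit must reach `v₀`, since `τ` cannot increase forever; so all of `V` is one orbit
without fixed points.) Deliberate dot-notation extension of `Equiv.Perm`. [folklore] -/
theorem cycleType_eq_card_of_potential (π : Perm α) (v₀ : α) (τ : α → ℕ)
    (h : ∀ x, π x ≠ v₀ → τ x < τ (π x)) (h2 : 2 ≤ Fintype.card α) :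
    π.cycleType = {Fintype.card α} := by
  -- along an orbit avoiding the arc into `v₀`, the potential grows at least linearly
  have grow : ∀ (x : α) (m : ℕ), (∀ i, i < m → (π ^ (i + 1)) x ≠ v₀) →
      τ x + m ≤ τ ((π ^ m) x) := by
    intro x m
    induction m with
    | zero => intro _; simp
    | succ m ih =>
      intro hm
      have h1 : τ x + m ≤ τ ((π ^ m) x) := ih fun i hi => hm i (Nat.lt_succ_of_lt hi)
      have h2 : (π ^ (m + 1)) x ≠ v₀ := hm m (Nat.lt_succ_self m)
      rw [pow_succ', Perm.mul_apply] at h2 ⊢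
      have h3 := h ((π ^ m) x) h2
      omega
  -- hence every orbit reaches `v₀`
  have reach : ∀ x : α, SameCycle π x v₀ := by
    intro x
    by_contra hx
    have hne : ∀ i, (π ^ (i + 1)) x ≠ v₀ := fun i hi => hx ⟨(i + 1 : ℕ), by exact_mod_cast hi⟩
    -- the potential is bounded on the finite type
    set B := Finset.univ.sup τ with hB
    have hle : ∀ y, τ y ≤ B := fun y => Finset.le_sup (Finset.mem_univ y)
    have := grow x (B + 1) fun i _ => hne i
    have := hle ((π ^ (B + 1)) x)
    omega
  -- and `π` has no fixed point
  have nofix : ∀ x : α, π x ≠ x := by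
    intro x hx
    by_cases hv : π x = v₀
    · -- then `x = v₀` is fixed and every orbit is `{v₀}`: `V` is a singleton
      have hxv : x = v₀ := hx.symm.trans hv
      subst hxv
      have hall : ∀ y : α, y = x := by
        intro y
        obtain ⟨i, hi⟩ := reach y
        have h1 : (π ^ i) y = (π ^ i) x := by
          rw [hi, zpow_apply_eq_self_of_apply_eq_self hx]
        exact (π ^ i).injective h1
      have hcard : Fintype.card α ≤ 1 := Fintype.card_le_one_iff.2 fun a b => (hall a).trans (hall b).symm
      omega
    · exact absurd (h x hv) (by rw [hx]; exact lt_irrefl _)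
  have hcyc : π.IsCycle := ⟨v₀, nofix v₀, fun y _ => (reach y).symm⟩
  have hsupp : π.support = Finset.univ :=
    Finset.eq_univ_iff_forall.2 fun x => Perm.mem_support.2 (nofix x)
  rw [hcyc.cycleType, hsupp, Finset.card_univ]

/-- **A full cycle has no short return**: if `cycleType π = {#V}` then `(π ^ m) x ≠ x` for all
`x` and `0 < m < #V` (the cycle through `x` has length `#V = orderOf π`;
`Equiv.Perm.IsCycle.pow_eq_one_iff`). Deliberate dot-notation extension of `Equiv.Perm`. [folklore] -/
theorem pow_apply_ne_self_of_cycleType {π : Perm α} (hπ : π.cycleType = {Fintype.card α})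
    {m : ℕ} (hm0 : 0 < m) (hm : m < Fintype.card α) (x : α) : (π ^ m) x ≠ x := by
  have hcyc : π.IsCycle := by
    rw [← card_cycleType_eq_one, hπ, Multiset.card_singleton]
  have hsup : π.support.card = Fintype.card α := by
    have h1 := hcyc.cycleType
    rw [hπ, Multiset.singleton_inj] at h1
    exact h1.symm
  have hx : π x ≠ x := by
    have : x ∈ π.support := by
      rw [(Finset.card_eq_iff_eq_univ _).1 hsup]
      exact Finset.mem_univ x
    exact Perm.mem_support.1 this
  intro hmx
  have h1 : π ^ m = 1 := hcyc.pow_eq_one_iff.2 ⟨x, hx, hmx⟩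
  have h2 : orderOf π ∣ m := orderOf_dvd_of_pow_eq_one h1
  rw [hcyc.orderOf, hsup] at h2
  exact absurd (Nat.le_of_dvd hm0 h2) (not_le.2 hm)

end Equiv.Perm

/-! ### `HC` under ring maps and renaming; vanishing terms -/

namespace Matrix

variable {n m : Type*} [Fintype n] [DecidableEq n] [Fintype m] [DecidableEq m]
variable {R S : Type*} [CommSemiring R] [CommSemiring S]

/-- The Hamiltonian cycle sum commutes with ring homomorphisms applied entrywise (it is a
polynomial in the entries with coefficients `0, 1`; cf. `Matrix.permanent_map_ringHom`).
Deliberate dot-notation extension of Mathlib's `Matrix` namespace. [folklore] -/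
theorem hamiltonianCycleSum_map_ringHom (f : R →+* S) (M : Matrix n n R) :
    (M.map f).hamiltonianCycleSum = f M.hamiltonianCycleSum := by
  simp [Matrix.hamiltonianCycleSum, map_sum, map_prod]

/-- Renaming the vertices along an equivalence does not change the Hamiltonian cycle sum:
`HC(M ∘ (e × e)) = HC(M)` (`Equiv.Perm.cycleType_permCongr`). Deliberate dot-notation
extension of `Matrix`. [folklore] -/
theorem hamiltonianCycleSum_submatrix_equiv (e : m ≃ n) (M : Matrix n n R) :
    (M.submatrix e e).hamiltonianCycleSum = M.hamiltonianCycleSum := by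
  unfold Matrix.hamiltonianCycleSum
  rw [← Finset.sum_equiv (e.permCongr) (s := Finset.univ.filter fun π : Perm m =>
      π.cycleType = {Fintype.card m}) (t := Finset.univ.filter fun π : Perm n =>
      π.cycleType = {Fintype.card n})
      (g := fun π : Perm n => ∏ i, M (π i) i)]
  · intro π
    simp only [Finset.mem_filter, Finset.mem_univ, true_and, Equiv.Perm.cycleType_permCongr,
      Fintype.card_congr e]
  · intro π _
    -- reindex the product along `e`
    refine Fintype.prod_equiv e _ _ fun i => ?_
    simp [Matrix.submatrix_apply, Equiv.permCongr_apply]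

omit [DecidableEq n] in
/-- A cover through a zero entry contributes nothing: if `M (π x) x = 0` for some `x` then the
term `∏_i M (π i) i` of `HC(M)` (and of `per M`) vanishes. [folklore] -/
theorem hamiltonianCycleSum_term_eq_zero {M : Matrix n n R} {π : Perm n} {x : n}
    (h : M (π x) x = 0) : ∏ i, M (π i) i = 0 :=
  Finset.prod_eq_zero (Finset.mem_univ x) h

end Matrix

/-! ### `HC` of a matrix over `k ∪ {X_i}` is a projection of the generic `HC_N` -/

namespace Literature.Computability.AlgebraicComplexity

open MvPolynomial

universe u v

variable {k : Type u} [CommSemiring k] {σ : Type v}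

/-- The Hamiltonian cycle sum `HC(A) ∈ k[X]` of a square matrix `A` over `I = k ∪ {X_i}`
(entries `k ⊕ σ`, valued by `entryVal`), the analogue of `entryPer` for the Hamiltonian cycle
polynomial (BCS 1997, (21.12) and Thm. (21.17): "`f_n` is a projection of `HC_m`"). [cite: BurgisserClausenShokrollahi1997, (21.12)] -/
def entryHC {ι : Type*} [Fintype ι] [DecidableEq ι] (A : Matrix ι ι (k ⊕ σ)) :
    MvPolynomial σ k :=
  (A.map entryVal).hamiltonianCycleSum

/-- Substituting polynomials for the variables of `HC(A)` is the Hamiltonian cycle sum of the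
substituted matrix (`HC` commutes with the algebra map `aeval s`). [cite: BurgisserClausenShokrollahi1997, (21.12)] -/
theorem aeval_entryHC {τ : Type*} (s : σ → MvPolynomial τ k) {ι : Type*} [Fintype ι]
    [DecidableEq ι] (A : Matrix ι ι (k ⊕ σ)) :
    aeval s (entryHC A) = (A.map fun a => aeval s (entryVal a)).hamiltonianCycleSum := by
  unfold entryHC
  rw [← AlgHom.coe_toRingHom, ← Matrix.hamiltonianCycleSum_map_ringHom, Matrix.map_map]
  rfl

/-- Renaming the index type of `A` along an equivalence does not change `HC(A)`. [folklore] -/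
theorem entryHC_submatrix_equiv {ι ι' : Type*} [Fintype ι] [DecidableEq ι] [Fintype ι']
    [DecidableEq ι'] (e : ι' ≃ ι) (A : Matrix ι ι (k ⊕ σ)) :
    entryHC (A.submatrix e e) = entryHC A := by
  unfold entryHC
  rw [← Matrix.hamiltonianCycleSum_submatrix_equiv e (A.map entryVal)]
  rfl

/-- **`HC(A)` is a projection of `HC_N`** for an `N × N` matrix `A` over `k ∪ {X_i}`:
substitute the entry `a_{ij} ∈ k ∪ {X_i}` for the variable `X_{ij}` of the generic Hamiltonian
cycle polynomial (Bürgisser 2000, Def. 2.6(1) and (2.3); BCS 1997, (21.12), the analogue of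
`isProjection_entryPer_perPoly`). [cite: Burgisser2000, Def. 2.6(1)] -/
theorem isProjection_entryHC_hcPoly {N : ℕ} (A : Matrix (Fin N) (Fin N) (k ⊕ σ)) :
    IsProjection (entryHC A) (hcPoly (Fin N) k) := by
  refine ⟨fun ij => entryVal (A ij.1 ij.2), fun ij => ?_, ?_⟩
  · show (∃ j, entryVal (A ij.1 ij.2) = X j) ∨ ∃ c, entryVal (A ij.1 ij.2) = C c
    rcases A ij.1 ij.2 with c | i
    · exact Or.inr ⟨c, rfl⟩
    · exact Or.inl ⟨i, rfl⟩
  · unfold hcPoly entryHC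
    rw [← AlgHom.coe_toRingHom, ← Matrix.hamiltonianCycleSum_map_ringHom]
    congr 1
    ext i j
    simp [Matrix.map_apply, Matrix.mvPolynomialX_apply]

end Literature.Computability.AlgebraicComplexity
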